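import Summits.Ventures.YMGap.RobustBall.AxialPairGeometry
import HarnessLib

/-!
# Venture YMGap, track ROBUST-BALL (tier 2) — geometry of GENERAL plaquette pairs on `ℤ^d`: carriers, fibres,
# and the index-sum bound from row and column sums

HONEST FRAMING. WHAT THIS IS: a venture file (cell `pub-ymgap`, track Y2 ROBUST-BALL, seat rb-p1), the
lattice COMBINATORICS behind the general two-plaquette coupling member `PairCoupling.lean` of the tier-2
ball. An ordered PAIR of plaquettes `i = (p, q)` (any orientations, any positions) carries the link set
`plaqPairCode i = edges p ∪ edges q`; we prove (1) links of `p` and of `q` have base points at `ℓ^∞`-distance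
`≤ ‖x_p - x_q‖_∞ + 1`; (2) the fibres `{i : plaqPairCode i = X}` are finite (`plaqPairFib X`, both plaquettes touch
`X`); (3) THE INDEX-SUM BOUND: for a nonnegative pair weight `w` with summable ROWS `∑_q w(p, q) ≤ K` and
COLUMNS `∑_p w(p, q) ≤ K'` (`K, K' ≥ 0`), every finite partial sum of `(𝟙[e ∈ edges p] + 𝟙[e ∈ edges q]) w(p, q)` is
`≤ 2(d - 1)(K + K')` (at most `2(d - 1)` plaquettes through a link). WHAT IT IS NOT: no measure, no
estimate about a Gibbs state, no number; nothing about the continuum limit or the Clay problem.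

References: folklore lattice geometry; `|{p ∋ e}| ≤ 2(d - 1)` is the tree's
`card_plaquettesTouching_singleton_le` (Shen–Zhu–Zhu, CMP 400 (2023), §2).
-/

noncomputable section

open Filter Function Topology Real Finset
open Literature.Probability.LatticeModels
open Literature.MathematicalPhysics.QuantumLattice
open Literature.MathematicalPhysics.QuantumFieldTheory hiding ZdEdge

namespace Summit.Ventures.YMGap.RobustBall

variable {d : ℕ}

/-! ### Carriers and distances -/

variable (d) in
/-- The index set of ordered plaquette pairs. -/
abbrev PlaqPairIdx : Type := ZdPlaquette d × ZdPlaquette d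

/-- The carrier of a plaquette pair: the links of the two plaquettes. -/
def plaqPairCode (i : PlaqPairIdx d) : Finset (ZdEdge d) := plaquetteEdges i.1 ∪ plaquetteEdges i.2

/-- Links of two plaquettes have base points at `ℓ^∞`-distance at most the distance of the base points plus
one (offsets inside a plaquette are `0` or `1` per coordinate). -/
theorem norm_sub_le_norm_base_sub_add_one {p q : ZdPlaquette d} {e y : ZdEdge d} (he : e ∈ plaquetteEdges p)
    (hy : y ∈ plaquetteEdges q) : ‖e.1 - y.1‖ ≤ ‖p.1 - q.1‖ + 1 := by
  refine (pi_norm_le_iff_of_nonneg (by positivity)).2 fun k => ?_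
  rw [Pi.sub_apply, Int.norm_eq_abs, Int.cast_sub]
  have h1 := apply_sub_eq_zero_or_one_of_mem_plaquetteEdges he k
  have h2 := apply_sub_eq_zero_or_one_of_mem_plaquetteEdges hy k
  have hk : |((p.1 k : ℤ) : ℝ) - (q.1 k : ℝ)| ≤ ‖p.1 - q.1‖ := by
    have h := norm_le_pi_norm (p.1 - q.1) k
    rw [Pi.sub_apply, Int.norm_eq_abs, Int.cast_sub] at h
    exact h
  have : ((e.1 k : ℤ) : ℝ) - (y.1 k : ℝ) =
      ((e.1 k - p.1 k : ℤ) : ℝ) - ((y.1 k - q.1 k : ℤ) : ℝ) + (((p.1 k : ℤ) : ℝ) - (q.1 k : ℝ)) := by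
    push_cast; ring
  rw [this]
  have hpq := abs_le.1 hk
  rcases h1 with h1 | h1 <;> rcases h2 with h2 | h2 <;> rw [h1, h2] <;>
    · rw [abs_le]; constructor <;> push_cast <;> linarith [hpq.1, hpq.2]

/-! ### Finite fibres -/

/-- On the fibre of `X` both plaquettes touch `X`. -/
theorem mem_plaquettesTouching_of_plaqPairCode_eq {i : PlaqPairIdx d} {X : Finset (ZdEdge d)} (h : plaqPairCode i = X) :
    i.1 ∈ plaquettesTouching X ∧ i.2 ∈ plaquettesTouching X :=
  ⟨mem_plaquettesTouching_iff.2 ⟨(i.1.1, i.1.2.1.1),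
      mem_inter.2 ⟨fst_mem_plaquetteEdges i.1, h ▸ mem_union_left _ (fst_mem_plaquetteEdges i.1)⟩⟩,
    mem_plaquettesTouching_iff.2 ⟨(i.2.1, i.2.2.1.1),
      mem_inter.2 ⟨fst_mem_plaquetteEdges i.2, h ▸ mem_union_right _ (fst_mem_plaquetteEdges i.2)⟩⟩⟩

/-- **The fibre enumeration**: the finitely many plaquette pairs carried by the link set `X`. -/
def plaqPairFib (X : Finset (ZdEdge d)) : Finset (PlaqPairIdx d) :=
  ((plaquettesTouching X) ×ˢ (plaquettesTouching X)).filter fun i => plaqPairCode i = X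

/-- Membership in the fibre enumeration is exactly `plaqPairCode i = X`. -/
theorem mem_plaqPairFib (X : Finset (ZdEdge d)) (i : PlaqPairIdx d) : i ∈ plaqPairFib X ↔ plaqPairCode i = X := by
  unfold plaqPairFib
  rw [mem_filter, mem_product]
  exact ⟨fun h => h.2, fun h => ⟨mem_plaquettesTouching_of_plaqPairCode_eq h, h⟩⟩

/-! ### The index-sum bound from row and column sums -/

section Sums

variable {w : PlaqPairIdx d → ℝ}

/-- **Partial sums over pairs whose FIRST plaquette contains `e`** are bounded by `2(d - 1)` row sums:
`∑_{i ∈ S} 𝟙[e ∈ edges p_i] w(i) ≤ 2(d - 1) K` if every row `∑_q w(p, q) ≤ K`. -/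
theorem sum_ite_fst_le_of_rows (hd : 1 ≤ d) (hw0 : ∀ i, 0 ≤ w i) (hrow : ∀ p, Summable fun q => w (p, q))
    {K : ℝ} (hK0 : 0 ≤ K) (hK : ∀ p, ∑' q, w (p, q) ≤ K) (e : ZdEdge d) (S : Finset (PlaqPairIdx d)) :
    ∑ i ∈ S, (if e ∈ plaquetteEdges i.1 then w i else 0) ≤ 2 * ((d : ℝ) - 1) * K := by
  classical
  set T : Finset (PlaqPairIdx d) := (plaquettesTouching {e}) ×ˢ (S.image Prod.snd) with hT
  have hsub : S.filter (fun i => e ∈ plaquetteEdges i.1) ⊆ T := by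
    intro i hi
    obtain ⟨hiS, hie⟩ := mem_filter.1 hi
    exact mem_product.2 ⟨mem_plaquettesTouching_singleton.2 hie, mem_image.2 ⟨i, hiS, rfl⟩⟩
  have hcard : ((plaquettesTouching {e}).card : ℝ) ≤ 2 * ((d : ℝ) - 1) := by
    calc ((plaquettesTouching {e}).card : ℝ) ≤ ((2 * (d - 1) : ℕ) : ℝ) := by
          exact_mod_cast card_plaquettesTouching_singleton_le e
      _ = 2 * ((d : ℝ) - 1) := by push_cast [Nat.cast_sub hd]; ring
  calc ∑ i ∈ S, (if e ∈ plaquetteEdges i.1 then w i else 0)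
      = ∑ i ∈ S.filter (fun i => e ∈ plaquetteEdges i.1), w i := by rw [sum_filter]
    _ ≤ ∑ i ∈ T, w i := sum_le_sum_of_subset_of_nonneg hsub fun i _ _ => hw0 i
    _ = ∑ p ∈ plaquettesTouching {e}, ∑ q ∈ S.image Prod.snd, w (p, q) := by rw [hT, sum_product]
    _ ≤ ∑ p ∈ plaquettesTouching {e}, K :=
        sum_le_sum fun p _ => ((hrow p).sum_le_tsum _ (fun q _ => hw0 _)).trans (hK p)
    _ = ((plaquettesTouching {e}).card : ℝ) * K := by rw [sum_const, nsmul_eq_mul]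
    _ ≤ 2 * ((d : ℝ) - 1) * K := mul_le_mul_of_nonneg_right hcard hK0

/-- **Partial sums over pairs whose SECOND plaquette contains `e`** are bounded by `2(d - 1)` column sums. -/
theorem sum_ite_snd_le_of_cols (hd : 1 ≤ d) (hw0 : ∀ i, 0 ≤ w i) (hcol : ∀ q, Summable fun p => w (p, q))
    {K' : ℝ} (hK'0 : 0 ≤ K') (hK' : ∀ q, ∑' p, w (p, q) ≤ K') (e : ZdEdge d) (S : Finset (PlaqPairIdx d)) :
    ∑ i ∈ S, (if e ∈ plaquetteEdges i.2 then w i else 0) ≤ 2 * ((d : ℝ) - 1) * K' := by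
  classical
  -- swap the pair and use the row bound for the swapped weight
  have h := sum_ite_fst_le_of_rows hd (w := fun i : PlaqPairIdx d => w i.swap) (fun i => hw0 _)
    (fun p => by simpa using hcol p) (K := K') hK'0 (fun p => by simpa using hK' p) e (S.image Prod.swap)
  rw [sum_image (fun i _ j _ hij => Prod.swap_injective hij)] at h
  simpa using h

/-- **THE INDEX-SUM BOUND through a link** for general pairs: a nonnegative index family dominated by
`(𝟙[e ∈ edges p] + 𝟙[e ∈ edges q]) w(p, q)`, with rows of `w` bounded by `K` and columns by `K'`, is
summable with sum `≤ 2(d - 1)(K + K')`. -/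
theorem summable_and_tsum_le_of_le_pair_incidence (hd : 1 ≤ d) (hw0 : ∀ i, 0 ≤ w i)
    (hrow : ∀ p, Summable fun q => w (p, q)) {K : ℝ} (hK0 : 0 ≤ K) (hK : ∀ p, ∑' q, w (p, q) ≤ K)
    (hcol : ∀ q, Summable fun p => w (p, q)) {K' : ℝ} (hK'0 : 0 ≤ K') (hK' : ∀ q, ∑' p, w (p, q) ≤ K')
    (e : ZdEdge d) {g : PlaqPairIdx d → ℝ} (hg0 : ∀ i, 0 ≤ g i)
    (hg : ∀ i, g i ≤ ((if e ∈ plaquetteEdges i.1 then (1 : ℝ) else 0) +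
        (if e ∈ plaquetteEdges i.2 then (1 : ℝ) else 0)) * w i) :
    Summable g ∧ ∑' i, g i ≤ 2 * ((d : ℝ) - 1) * (K + K') := by
  have hS : ∀ S : Finset (PlaqPairIdx d), ∑ i ∈ S, g i ≤ 2 * ((d : ℝ) - 1) * (K + K') := by
    intro S
    have h1 := sum_ite_fst_le_of_rows hd hw0 hrow hK0 hK e S
    have h2 := sum_ite_snd_le_of_cols hd hw0 hcol hK'0 hK' e S
    have heq : ∑ i ∈ S, ((if e ∈ plaquetteEdges i.1 then (1 : ℝ) else 0) +
        (if e ∈ plaquetteEdges i.2 then (1 : ℝ) else 0)) * w i =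
        ∑ i ∈ S, (if e ∈ plaquetteEdges i.1 then w i else 0) +
          ∑ i ∈ S, (if e ∈ plaquetteEdges i.2 then w i else 0) := by
      rw [← sum_add_distrib]
      refine sum_congr rfl fun i _ => ?_
      split_ifs <;> ring
    calc ∑ i ∈ S, g i ≤ _ := sum_le_sum fun i _ => hg i
      _ = _ := heq
      _ ≤ 2 * ((d : ℝ) - 1) * K + 2 * ((d : ℝ) - 1) * K' := add_le_add h1 h2
      _ = 2 * ((d : ℝ) - 1) * (K + K') := by ring
  exact ⟨summable_of_sum_le hg0 hS, Real.tsum_le_of_sum_le hg0 hS⟩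

end Sums

end Summit.Ventures.YMGap.RobustBall
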